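import Summits.BirchSwinnertonDyer.BirchSwinnertonDyer.Theorems.GenusKolyvaginAtTwoVisiblePairAtTwoCasselsTateKernel
import Summits.BirchSwinnertonDyer.BirchSwinnertonDyer.Theorems.GenusKolyvaginAtTwoVisiblePairAtTwoInputPair
import Literature.NumberTheory.EllipticCurves.TwoAdicImageQuadraticTwistProofs
import Literature.NumberTheory.EllipticCurves.TwoAdicImageSurjectivityModTwoProofs
import HarnessLib

/-!
# Route `GenusKolyvaginAtTwo`, crux `KolyvaginExactAtTwo` (22137) → Q3-inner (24882 / 27720):
# the Cassels–Tate block of the `ℚ`-pair capstone from LEVEL PAIRINGS on `Ш(E/ℚ)[2^L]`, `Ш(E^{(d_K)}/ℚ)[2^L]`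

Seat `bsd-line-gk2-p2` g12 (cell `bsd-f1-sign2`). THEOREMS ONLY (no definition, no named fact, no `sorry`). Part 2 of 2
(part 1: `…VisiblePairAtTwoCasselsTateKernel`, the Kummer/level-pairing kernel lemmas over any number field).

The capstone `selmer_eq_and_card_selmer_twin_eq_of_input_pair` (`…VisiblePairAtTwoInputPair`, p648690) displays
the Cassels–Tate data over `ℚ` as EIGHT opaque hypotheses on two pairings `P₁`, `P₂` on the Selmer groups
`Sel_{2^M}(E/ℚ)`, `Sel_{2^M}(E^{(d_K)}/ℚ)`: alternation (`halt₁`, `halt₂`), `P₁(x, ·) = 0` (`hPx`), non-degeneracy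
modulo `ℤx` / non-degeneracy (`hnd₁`, `hnd₂`) and the value formula `hCTV`.  This file derives the first SEVEN
from: two LEVEL PAIRINGS `B₁`, `B₂` on `Ш(E/ℚ)[2^L]`, `Ш(E^{(d_K)}/ℚ)[2^L]` (`IsLevelPairing`: alternating, kernel
`Ш[2^L] ∩ 2^L Ш` — Milne I Prop. 6.9 / Thm. 6.13(a), Cassels 1962; any `L` with `2M₀ ≤ L ≤ M`), pulled back along maps
`ι_i : Sel_{2^M} → Ш[2^L]` (which exist, §4), and `x ∈ δ(E(ℚ))` (`torsionH1ToH1 x = 0`).  NO finiteness of `Ш` and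
NO rank statement is assumed: the exponent bounds come from the descent's own Claims A/B
(`pow_zsmul_selmer_eq_zero_and_selmer_le`, gk2-p3's instance of gk2-p2's
`VisiblePairHypothesesM.pow_zsmul_sel₂_eq_zero_and_sel₁_le`) and the Kummer sequence over `ℚ`
(`E(ℚ)[2] = E^{(d_K)}(ℚ)[2] = 0` from `ρ̄_{E,2}` onto, Dokchitser–Dokchitser, twist-invariant).

* §4 the instance: `zsmul_torsionH1ToH1_selmer_twin_eq_zero`, `zsmul_torsionH1ToH1_selmer_eq_zero` (Claims A/B on
  `Ш`-images), `sha_twin_zsmul_eq_zero`, `sha_zsmul_eq_zero` (`Ш[2^{2L}] ⊆ Ш[2^L]`), `exists_selmerToSha_of_input`,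
  `exists_selmerToSha_twin_of_input` (the maps `ι_i`);
* §5 `selmer_eq_and_card_selmer_twin_eq_of_levelPairings` — the capstone with the Cassels–Tate block REPLACED by
  `hL hLM B₁ hB₁ ι₁ hι₁ B₂ hB₂ ι₂ hι₂ hx` and the value formula `hCTV` for the pulled-back pairings
  `P_i := (B_i.comp ι_i).compl₂ ι_i`, i.e. `P_i(z, t) = B_i(ι_i z, ι_i t)`.

What remains displayed of the Cassels–Tate input after this file: the EXISTENCE of level pairings on `Ш(E/ℚ)[2^L]` and
`Ш(E^{(d_K)}/ℚ)[2^L]` (for `ctLevelPairing`: the tree's `isLevelPairing_ctLevelPairing_of_inputs` modulo `hH3`, `hPTc`,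
`h615` and alternation at the even level `2^L`) and the value formula `hCTV` (McCallum Prop. 4.7 + Lemma 5.3 at `λ`).
BSD is not proved by any of this.

References: [McCallumLMS1991] W. G. McCallum, *Kolyvagin's work on Shafarevich–Tate groups*, LMS LNS 153 (1991),
§2 (1), Prop. 5.2, Thm. 5.4 (proof); [MilneADT2006] J. S. Milne, *Arithmetic Duality Theorems*, I §6 Prop. 6.9,
Thm. 6.13(a); [Kolyvagin1989Izv] §3 Thm. B_l (l = 2); [DokchitserDokchitserMathZ2012] Thm. (1).
-/

set_option linter.dupNamespace false -- tree convention: `Summit.BirchSwinnertonDyer.BirchSwinnertonDyer.Theorems` (summit = sub-problem)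
set_option autoImplicit false

noncomputable section

open scoped Classical
open scoped AddSubgroup

namespace Summit.BirchSwinnertonDyer.BirchSwinnertonDyer.Theorems.GenusExact.VisiblePairAtTwo

open WeierstrassCurve NumberField IsDedekindDomain Field Rat.HeightOneSpectrum
open Literature.NumberTheory.EllipticCurves Literature.NumberTheory.GaloisRepresentations
open Literature.NumberTheory.EllipticCurves.KolyvaginDescent
open Literature.GroupTheory.FiniteAbelian

/-! ## §4. The instance: exponents of the `Ш`-images from Claims A and B -/

section Instance

variable {W : WeierstrassCurve ℚ} [W.IsElliptic] [W.IsGloballyMinimal] {K : Type} [Field K] [NumberField K]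
  {M : ℕ} {θ : K} {hθ : θ ∉ Set.range (algebraMap ℚ K)}
  {hθsq : θ ^ 2 = algebraMap ℚ K ((NumberField.discr K : ℤ) : ℚ)} [(twin W K).IsElliptic]

/-- **Claim A on `Ш`-images**: `2^L` kills the image of `Sel_{2^M}(E^{(d_K)}/ℚ)` in `H¹(ℚ, E^{(d_K)})` for
`M₀ ≤ L` (`2^{M₀} Sel_{2^M}(E^{(d_K)}/ℚ) = 0`, `pow_zsmul_selmer_eq_zero_and_selmer_le`). [cite: Kolyvagin1989Izv, §3 (Thm. B_l, l = 2)] -/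
theorem zsmul_torsionH1ToH1_selmer_twin_eq_zero (I : Input W K M hθ hθsq) {L : ℕ} (hL : I.M₀ ≤ L) :
    ∀ z ∈ selmerGroup (twin W K) (lvl M), ((2 : ℤ) ^ L) • torsionH1ToH1 (twin W K) (lvl M) z = 0 := by
  intro z hz
  have h := (pow_zsmul_selmer_eq_zero_and_selmer_le I).1 z hz
  rw [show L = (L - I.M₀) + I.M₀ by omega, pow_add, mul_smul, ← map_zsmul, h, map_zero, zsmul_zero]

/-- **Claim B on `Ш`-images**: `2^L` kills the image of `Sel_{2^M}(E/ℚ)` in `H¹(ℚ, E)` for `2M₀ ≤ L`, when `x` dies in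
`H¹(ℚ, E)` (`2^{2M₀} Sel_{2^M}(E/ℚ) ⊆ ℤx`, `pow_zsmul_selmer_eq_zero_and_selmer_le`). [cite: Kolyvagin1989Izv, §3 (Thm. B_l, l = 2)] -/
theorem zsmul_torsionH1ToH1_selmer_eq_zero (I : Input W K M hθ hθsq) (hx : torsionH1ToH1 W (lvl M) I.x = 0) {L : ℕ}
    (hL : 2 * I.M₀ ≤ L) :
    ∀ z ∈ selmerGroup W (lvl M), ((2 : ℤ) ^ L) • torsionH1ToH1 W (lvl M) z = 0 := by
  intro z hz
  obtain ⟨a, ha⟩ := (pow_zsmul_selmer_eq_zero_and_selmer_le I).2 z hz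
  rw [show L = (L - 2 * I.M₀) + 2 * I.M₀ by omega, pow_add, mul_smul, ← map_zsmul, ha, map_zsmul, hx, zsmul_zero,
    zsmul_zero]

/-- **`Ш(E^{(d_K)}/ℚ)[2^{2L}] ⊆ Ш(E^{(d_K)}/ℚ)[2^L]`** for `M₀ ≤ L`, `M₀ < M`: the `2^M`-torsion of `Ш` lifts to
`Sel_{2^M}` (Kummer sequence) where Claim A kills it by `2^{M₀}`, and `pow_zsmul_eq_zero_of_lt` bounds ALL the
`2`-power torsion of `Ш(E^{(d_K)}/ℚ)` by `2^{M₀}` — no finiteness of `Ш` is used or proved. [cite: McCallumLMS1991, §5 Thm. 5.4 (proof)] -/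
theorem sha_twin_zsmul_eq_zero (I : Input W K M hθ hθsq) (hM : I.M₀ < M) {L : ℕ} (hL : I.M₀ ≤ L) :
    ∀ a ∈ (twin W K).sha, ((2 : ℤ) ^ (2 * L)) • a = 0 → ((2 : ℤ) ^ L) • a = 0 := by
  have hM' : ∀ a ∈ (twin W K).sha, ((2 : ℤ) ^ M) • a = 0 → ((2 : ℤ) ^ I.M₀) • a = 0 := by
    intro a ha hMa
    obtain ⟨t, ht, rfl⟩ := exists_selmer_lift (W := twin W K) (m := 2 ^ M) ha
      (by rw [Nat.cast_pow, Nat.cast_ofNat]; exact hMa)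
    exact zsmul_torsionH1ToH1_selmer_twin_eq_zero I le_rfl t ht
  intro a ha h2L
  have h := pow_zsmul_eq_zero_of_lt (twin W K).sha hM hM' (2 * L) a ha h2L
  rw [show L = (L - I.M₀) + I.M₀ by omega, pow_add, mul_smul, h, zsmul_zero]

/-- **`Ш(E/ℚ)[2^{2L}] ⊆ Ш(E/ℚ)[2^L]`** for `2M₀ ≤ L`, `2M₀ < M`, when `x` dies in `H¹(ℚ, E)`: Claim B kills the `2^M`-torsion
of `Ш(E/ℚ)` by `2^{2M₀}`, and `pow_zsmul_eq_zero_of_lt` bounds all its `2`-power torsion — no finiteness of `Ш` is used or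
proved. [cite: McCallumLMS1991, §5 Thm. 5.4 (proof)] -/
theorem sha_zsmul_eq_zero (I : Input W K M hθ hθsq) (hx : torsionH1ToH1 W (lvl M) I.x = 0) (hM : 2 * I.M₀ < M) {L : ℕ}
    (hL : 2 * I.M₀ ≤ L) : ∀ a ∈ W.sha, ((2 : ℤ) ^ (2 * L)) • a = 0 → ((2 : ℤ) ^ L) • a = 0 := by
  have hM' : ∀ a ∈ W.sha, ((2 : ℤ) ^ M) • a = 0 → ((2 : ℤ) ^ (2 * I.M₀)) • a = 0 := by
    intro a ha hMa
    obtain ⟨t, ht, rfl⟩ := exists_selmer_lift (W := W) (m := 2 ^ M) ha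
      (by rw [Nat.cast_pow, Nat.cast_ofNat]; exact hMa)
    exact zsmul_torsionH1ToH1_selmer_eq_zero I hx le_rfl t ht
  intro a ha h2L
  have h := pow_zsmul_eq_zero_of_lt W.sha hM hM' (2 * L) a ha h2L
  rw [show L = (L - 2 * I.M₀) + 2 * I.M₀ by omega, pow_add, mul_smul, h, zsmul_zero]

/-- **The maps `ι₁ : Sel_{2^M}(E/ℚ) → Ш(E/ℚ)[2^L]` exist** for `2M₀ ≤ L` when `x` dies in `H¹(ℚ, E)`.
[cite: MilneADT2006, Ch. I §6, (6.14)] -/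
theorem exists_selmerToSha_of_input (I : Input W K M hθ hθsq) (hx : torsionH1ToH1 W (lvl M) I.x = 0) {L : ℕ}
    (hL : 2 * I.M₀ ≤ L) :
    ∃ ι₁ : selmerGroup W (lvl M) →+ (W.sha)[(2 ^ L : ℕ)],
      ∀ z, shaTorsionVal W (2 ^ L) (ι₁ z) = torsionH1ToH1 W (lvl M) z :=
  exists_selmerToSha W M L (zsmul_torsionH1ToH1_selmer_eq_zero I hx hL)

/-- **The maps `ι₂ : Sel_{2^M}(E^{(d_K)}/ℚ) → Ш(E^{(d_K)}/ℚ)[2^L]` exist** for `M₀ ≤ L`. [cite: MilneADT2006, Ch. I §6, (6.14)] -/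
theorem exists_selmerToSha_twin_of_input (I : Input W K M hθ hθsq) {L : ℕ} (hL : I.M₀ ≤ L) :
    ∃ ι₂ : selmerGroup (twin W K) (lvl M) →+ ((twin W K).sha)[(2 ^ L : ℕ)],
      ∀ z, shaTorsionVal (twin W K) (2 ^ L) (ι₂ z) = torsionH1ToH1 (twin W K) (lvl M) z :=
  exists_selmerToSha (twin W K) M L (zsmul_torsionH1ToH1_selmer_twin_eq_zero I hL)

/-! ## §5. The capstone from level pairings -/

/-- **Exactness of `visiblePair I` with the Cassels–Tate block supplied by LEVEL PAIRINGS.** As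
`selmer_eq_and_card_selmer_twin_eq_of_input_pair` (p648690), but the eight Cassels–Tate hypotheses
`P₁ P₂ halt₁ halt₂ hPx hnd₁ hnd₂ hCTV` are REPLACED by: a level `L` with `2M₀ ≤ L ≤ M`; level pairings `B₁` on
`Ш(E/ℚ)[2^L]` and `B₂` on `Ш(E^{(d_K)}/ℚ)[2^L]` (`IsLevelPairing`: alternating with kernel `Ш[2^L] ∩ 2^L Ш` — for the
Cassels–Tate pairing this is Milne I Prop. 6.9 / Thm. 6.13(a) with Cassels' alternation); the maps `ι_i : Sel_{2^M} → Ш[2^L]`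
(which EXIST: `exists_selmerToSha_of_input`, `exists_selmerToSha_twin_of_input`); `x ∈ δ(E(ℚ))` (`hx`); and the value
formula `hCTV` for the pulled-back pairings `P_i(z, t) = B_i(ι_i z, ι_i t)`.  Alternation transfers; `P₁(x, ·) = 0` since
`ι₁ x = 0`; NON-DEGENERACY (`hnd₂`) and NON-DEGENERACY MODULO `ℤx` (`hnd₁`) are PROVED from the level-pairing kernel,
Claims A/B (`pow_zsmul_selmer_eq_zero_and_selmer_le`), the Kummer sequence over `ℚ` and `E(ℚ)[2] = E^{(d_K)}(ℚ)[2] = 0`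
(`ρ̄_{E,2}` onto; Dokchitser–Dokchitser, twist-invariant) — WITHOUT any finiteness-of-`Ш` or rank input.
[cite: McCallumLMS1991, §2 (1), Prop. 5.2, Thm. 5.4 (proof)] [cite: MilneADT2006, Ch. I §6, Prop. 6.9, Thm. 6.13(a)]
[cite: DokchitserDokchitserMathZ2012, Theorem (1)] -/
theorem selmer_eq_and_card_selmer_twin_eq_of_levelPairings (I : Input W K M hθ hθsq) (I₁ : Input W K 1 hθ hθsq)
    (hcm : ¬ W.HasCM) (hΔ : W.Δ < 0) (hK : IsImaginaryQuadratic K) (hodd : Odd (NumberField.discr K))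
    (hns : ¬ IsSquare ((NumberField.discr K : ℚ) * -|W.Δ|))
    (hρ : ∀ n : ℕ, W.HasSurjectiveModNGaloisRep (2 ^ n : ℕ)) (hM : 1 ≤ M)
    -- the level pairings and the maps `ι`
    {L : ℕ} (hL : 2 * I.M₀ ≤ L) (hLM : L ≤ M)
    (B₁ : (W.sha)[(2 ^ L : ℕ)] →+ (W.sha)[(2 ^ L : ℕ)] →+ AddCircle (1 : ℚ)) (hB₁ : IsLevelPairing (2 ^ L) B₁)
    (ι₁ : selmerGroup W (lvl M) →+ (W.sha)[(2 ^ L : ℕ)])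
    (hι₁ : ∀ z, shaTorsionVal W (2 ^ L) (ι₁ z) = torsionH1ToH1 W (lvl M) z)
    (B₂ : ((twin W K).sha)[(2 ^ L : ℕ)] →+ ((twin W K).sha)[(2 ^ L : ℕ)] →+ AddCircle (1 : ℚ))
    (hB₂ : IsLevelPairing (2 ^ L) B₂)
    (ι₂ : selmerGroup (twin W K) (lvl M) →+ ((twin W K).sha)[(2 ^ L : ℕ)])
    (hι₂ : ∀ z, shaTorsionVal (twin W K) (2 ^ L) (ι₂ z) = torsionH1ToH1 (twin W K) (lvl M) z)
    (hx : torsionH1ToH1 W (lvl M) I.x = 0)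
    -- the value formula for the pulled-back pairings
    (hCTV : ∀ ℓ m : ℕ, (visiblePair I).Kol ℓ → KolSupp (visiblePair I).Kol (ℓ * m) → ¬ ℓ ∣ m →
      ∀ (j N a b : ℕ) (t : galH1Torsion W (lvl M) × galH1Torsion (twin W K) (lvl M))
        (ht : t ∈ (visiblePair I).toVisibleSplit.Sel)
        (hz : (((visiblePair I).p : ℤ) ^ j) • (visiblePair I).toVisibleSplit.c (ℓ * m) ∈
          (visiblePair I).toVisibleSplit.Sel),
      (((visiblePair I).p : ℤ) ^ N) • t = 0 →
      t ∈ (visiblePair I).toVisibleSplit.part (1 * (-1) ^ (ℓ * m).primeFactors.card) →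
      (∀ q ∈ m.primeFactors, t ∈ (visiblePair I).toVisibleSplit.A q) →
      (visiblePair I).M - (visiblePair I).M₀ ≤ j → N + (visiblePair I).M₀ ≤ (visiblePair I).M → N ≤ j →
      a + b + 1 = N →
      (((visiblePair I).p : ℤ) ^ (a + (j - N))) • (visiblePair I).toVisibleSplit.c m ∉
        (visiblePair I).toVisibleSplit.A ℓ →
      (((visiblePair I).p : ℤ) ^ b) • t ∉ (visiblePair I).toVisibleSplit.A ℓ →
      (visiblePair I).prodPairing ((B₁.comp ι₁).compl₂ ι₁) ((B₂.comp ι₂).compl₂ ι₂) ⟨_, hz⟩ ⟨t, ht⟩ ≠ 0)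
    (h3 : 3 * I.M₀ ≤ M)
    -- the shallow certificate, in class form, and the remaining level-`2` inputs
    {ℓ₀ : ℕ} (hkol₀ : kolPrime W K 1 ℓ₀) (hy0 : I₁.c₂ ℓ₀ ≠ 0) (h0 : I₁.c₁ 1 = 0)
    (h44ord : ∀ ℓ, kolPrime W K M ℓ → ℓ ≠ ℓ₀ → (I₁.c₁ (ℓ * ℓ₀) ∈ a₁ W 1 ℓ₀ ↔ I₁.c₂ ℓ ∈ a₂ W K 1 ℓ₀))
    (hι : ∀ ℓ, kolPrime W K M ℓ →
      torsionH1OfDvd (twin W K) (lvl_one_dvd_lvl hM) (I₁.c₂ ℓ) = ((2 : ℤ) ^ (M - 1)) • I.c₂ ℓ) :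
    selmerGroup W (lvl M) = AddSubgroup.zmultiples I.x ∧
      Nat.card (selmerGroup (twin W K) (lvl M)) = 2 ^ (2 * I.M₀) := by
  -- `E(ℚ)[2] = 0` and `E^{(d_K)}(ℚ)[2] = 0` from `ρ̄_{E,2}` onto (twist-invariant)
  have hρ2 : W.HasSurjectiveModNGaloisRep 2 := by simpa using hρ 1
  have hd : ((NumberField.discr K : ℤ) : ℚ) ≠ 0 := by exact_mod_cast NumberField.discr_ne_zero K
  have hρ2' : (twin W K).HasSurjectiveModNGaloisRep 2 := (hasSurjectiveModNGaloisRep_two_quadraticTwist_iff W hd).mpr hρ2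
  have h2W := DokchitserDokchitser2012.forall_two_nsmul_of_hasSurjectiveModNGaloisRep_two W two_ne_zero hρ2
  have h2twin := DokchitserDokchitser2012.forall_two_nsmul_of_hasSurjectiveModNGaloisRep_two (twin W K) two_ne_zero hρ2'
  have hM₀ : I.M₀ < M := by omega
  have h2M₀ : 2 * I.M₀ < M := by omega
  have hL' : I.M₀ ≤ L := by omega
  refine selmer_eq_and_card_selmer_twin_eq_of_input_pair I I₁ hcm hΔ hK hodd hns hρ hM ((B₁.comp ι₁).compl₂ ι₁)
    (fun z ↦ hB₁.1 (ι₁ z)) (fun t ↦ ?_) (fun z hz ↦ ?_) ((B₂.comp ι₂).compl₂ ι₂) (fun z ↦ hB₂.1 (ι₂ z))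
    (fun z hz ↦ ?_) hCTV h3 hkol₀ hy0 h0 h44ord hι
  · -- `hPx`: `ι₁ x = 0`
    have h0x : ι₁ ⟨I.x, I.x_mem⟩ = 0 := (selmerToSha_eq_zero_iff ι₁ hι₁ _).mpr hx
    change B₁ (ι₁ ⟨I.x, I.x_mem⟩) (ι₁ t) = 0
    rw [h0x, map_zero, AddMonoidHom.zero_apply]
  · -- `hnd₁`: the level-pairing kernel, Claim B and the Kummer sequence
    exact mem_zmultiples_of_torsionH1ToH1_eq_zero_of_selmer_le h2M₀ h2W hx I.x_ord
      (pow_zsmul_selmer_eq_zero_and_selmer_le I).2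
      (torsionH1ToH1_eq_zero_of_forall_levelPairing_eq_zero B₁ ι₁ hι₁ hB₁ hLM (sha_zsmul_eq_zero I hx h2M₀ hL) hz)
  · -- `hnd₂`: the level-pairing kernel, Claim A and the Kummer sequence
    exact Subtype.ext (eq_zero_of_torsionH1ToH1_eq_zero_of_pow_zsmul_selmer hM₀ h2twin
      (pow_zsmul_selmer_eq_zero_and_selmer_le I).1
      (torsionH1ToH1_eq_zero_of_forall_levelPairing_eq_zero B₂ ι₂ hι₂ hB₂ hLM (sha_twin_zsmul_eq_zero I hM₀ hL') hz))

/-! ### The same capstone with the value formula restricted to `2^{2M₀}`-torsion classes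

Appended by seat `bsd-line-gk2-p2` g12: `selmer_eq_and_card_selmer_twin_eq_of_levelPairings` VERBATIM, with `hCTV` assumed only for `t` with
`2^{2M₀} t = 0` — the only classes the telescope applies it to (Selmer eigenclasses independent of `x`,
Literature `exists_chain_of_casselsTate_of_torsion`), and the form in which the Cassels–Tate pairings pulled
back to `Sel_{2^M}` actually satisfy it. -/

/-- **`selmer_eq_and_card_selmer_twin_eq_of_levelPairings`, value formula on `2^{2M₀}`-torsion classes only** (extra antecedent
`2^{2M₀} t = 0` in `hCTV`; everything else verbatim). [cite: McCallumLMS1991, Prop. 5.2, Thm. 5.4, Cor. 5.6]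
[cite: Kolyvagin1989Izv, §3] -/
theorem selmer_eq_and_card_selmer_twin_eq_of_levelPairings_of_torsion (I : Input W K M hθ hθsq) (I₁ : Input W K 1 hθ hθsq)
    (hcm : ¬ W.HasCM) (hΔ : W.Δ < 0) (hK : IsImaginaryQuadratic K) (hodd : Odd (NumberField.discr K))
    (hns : ¬ IsSquare ((NumberField.discr K : ℚ) * -|W.Δ|))
    (hρ : ∀ n : ℕ, W.HasSurjectiveModNGaloisRep (2 ^ n : ℕ)) (hM : 1 ≤ M)
    -- the level pairings and the maps `ι`
    {L : ℕ} (hL : 2 * I.M₀ ≤ L) (hLM : L ≤ M)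
    (B₁ : (W.sha)[(2 ^ L : ℕ)] →+ (W.sha)[(2 ^ L : ℕ)] →+ AddCircle (1 : ℚ)) (hB₁ : IsLevelPairing (2 ^ L) B₁)
    (ι₁ : selmerGroup W (lvl M) →+ (W.sha)[(2 ^ L : ℕ)])
    (hι₁ : ∀ z, shaTorsionVal W (2 ^ L) (ι₁ z) = torsionH1ToH1 W (lvl M) z)
    (B₂ : ((twin W K).sha)[(2 ^ L : ℕ)] →+ ((twin W K).sha)[(2 ^ L : ℕ)] →+ AddCircle (1 : ℚ))
    (hB₂ : IsLevelPairing (2 ^ L) B₂)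
    (ι₂ : selmerGroup (twin W K) (lvl M) →+ ((twin W K).sha)[(2 ^ L : ℕ)])
    (hι₂ : ∀ z, shaTorsionVal (twin W K) (2 ^ L) (ι₂ z) = torsionH1ToH1 (twin W K) (lvl M) z)
    (hx : torsionH1ToH1 W (lvl M) I.x = 0)
    -- the value formula for the pulled-back pairings
    (hCTV : ∀ ℓ m : ℕ, (visiblePair I).Kol ℓ → KolSupp (visiblePair I).Kol (ℓ * m) → ¬ ℓ ∣ m →
      ∀ (j N a b : ℕ) (t : galH1Torsion W (lvl M) × galH1Torsion (twin W K) (lvl M))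
        (ht : t ∈ (visiblePair I).toVisibleSplit.Sel)
        (hz : (((visiblePair I).p : ℤ) ^ j) • (visiblePair I).toVisibleSplit.c (ℓ * m) ∈
          (visiblePair I).toVisibleSplit.Sel),
      (((visiblePair I).p : ℤ) ^ N) • t = 0 → (((visiblePair I).p : ℤ) ^ (2 * (visiblePair I).M₀)) • t = 0 →
      t ∈ (visiblePair I).toVisibleSplit.part (1 * (-1) ^ (ℓ * m).primeFactors.card) →
      (∀ q ∈ m.primeFactors, t ∈ (visiblePair I).toVisibleSplit.A q) →
      (visiblePair I).M - (visiblePair I).M₀ ≤ j → N + (visiblePair I).M₀ ≤ (visiblePair I).M → N ≤ j →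
      a + b + 1 = N →
      (((visiblePair I).p : ℤ) ^ (a + (j - N))) • (visiblePair I).toVisibleSplit.c m ∉
        (visiblePair I).toVisibleSplit.A ℓ →
      (((visiblePair I).p : ℤ) ^ b) • t ∉ (visiblePair I).toVisibleSplit.A ℓ →
      (visiblePair I).prodPairing ((B₁.comp ι₁).compl₂ ι₁) ((B₂.comp ι₂).compl₂ ι₂) ⟨_, hz⟩ ⟨t, ht⟩ ≠ 0)
    (h3 : 3 * I.M₀ ≤ M)
    -- the shallow certificate, in class form, and the remaining level-`2` inputs
    {ℓ₀ : ℕ} (hkol₀ : kolPrime W K 1 ℓ₀) (hy0 : I₁.c₂ ℓ₀ ≠ 0) (h0 : I₁.c₁ 1 = 0)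
    (h44ord : ∀ ℓ, kolPrime W K M ℓ → ℓ ≠ ℓ₀ → (I₁.c₁ (ℓ * ℓ₀) ∈ a₁ W 1 ℓ₀ ↔ I₁.c₂ ℓ ∈ a₂ W K 1 ℓ₀))
    (hι : ∀ ℓ, kolPrime W K M ℓ →
      torsionH1OfDvd (twin W K) (lvl_one_dvd_lvl hM) (I₁.c₂ ℓ) = ((2 : ℤ) ^ (M - 1)) • I.c₂ ℓ) :
    selmerGroup W (lvl M) = AddSubgroup.zmultiples I.x ∧
      Nat.card (selmerGroup (twin W K) (lvl M)) = 2 ^ (2 * I.M₀) := by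
  -- `E(ℚ)[2] = 0` and `E^{(d_K)}(ℚ)[2] = 0` from `ρ̄_{E,2}` onto (twist-invariant)
  have hρ2 : W.HasSurjectiveModNGaloisRep 2 := by simpa using hρ 1
  have hd : ((NumberField.discr K : ℤ) : ℚ) ≠ 0 := by exact_mod_cast NumberField.discr_ne_zero K
  have hρ2' : (twin W K).HasSurjectiveModNGaloisRep 2 := (hasSurjectiveModNGaloisRep_two_quadraticTwist_iff W hd).mpr hρ2
  have h2W := DokchitserDokchitser2012.forall_two_nsmul_of_hasSurjectiveModNGaloisRep_two W two_ne_zero hρ2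
  have h2twin := DokchitserDokchitser2012.forall_two_nsmul_of_hasSurjectiveModNGaloisRep_two (twin W K) two_ne_zero hρ2'
  have hM₀ : I.M₀ < M := by omega
  have h2M₀ : 2 * I.M₀ < M := by omega
  have hL' : I.M₀ ≤ L := by omega
  refine selmer_eq_and_card_selmer_twin_eq_of_input_pair_of_torsion I I₁ hcm hΔ hK hodd hns hρ hM ((B₁.comp ι₁).compl₂ ι₁)
    (fun z ↦ hB₁.1 (ι₁ z)) (fun t ↦ ?_) (fun z hz ↦ ?_) ((B₂.comp ι₂).compl₂ ι₂) (fun z ↦ hB₂.1 (ι₂ z))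
    (fun z hz ↦ ?_) hCTV h3 hkol₀ hy0 h0 h44ord hι
  · -- `hPx`: `ι₁ x = 0`
    have h0x : ι₁ ⟨I.x, I.x_mem⟩ = 0 := (selmerToSha_eq_zero_iff ι₁ hι₁ _).mpr hx
    change B₁ (ι₁ ⟨I.x, I.x_mem⟩) (ι₁ t) = 0
    rw [h0x, map_zero, AddMonoidHom.zero_apply]
  · -- `hnd₁`: the level-pairing kernel, Claim B and the Kummer sequence
    exact mem_zmultiples_of_torsionH1ToH1_eq_zero_of_selmer_le h2M₀ h2W hx I.x_ord
      (pow_zsmul_selmer_eq_zero_and_selmer_le I).2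
      (torsionH1ToH1_eq_zero_of_forall_levelPairing_eq_zero B₁ ι₁ hι₁ hB₁ hLM (sha_zsmul_eq_zero I hx h2M₀ hL) hz)
  · -- `hnd₂`: the level-pairing kernel, Claim A and the Kummer sequence
    exact Subtype.ext (eq_zero_of_torsionH1ToH1_eq_zero_of_pow_zsmul_selmer hM₀ h2twin
      (pow_zsmul_selmer_eq_zero_and_selmer_le I).1
      (torsionH1ToH1_eq_zero_of_forall_levelPairing_eq_zero B₂ ι₂ hι₂ hB₂ hLM (sha_twin_zsmul_eq_zero I hM₀ hL') hz))

end Instance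

end Summit.BirchSwinnertonDyer.BirchSwinnertonDyer.Theorems.GenusExact.VisiblePairAtTwo

end
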